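import Literature.AlgebraicGeometry.ShimuraVarieties.UnitaryBallFormPullback
import Literature.Geometry.Kaehler.HolomorphicFormsInCharts
import Literature.Analysis.Complex.SeveralVariables
import HarnessLib

/-!
# Pull-backs of holomorphic forms are holomorphic automorphic forms

Let `D : UnitaryBallUniformisationDatum 2 X₂` be a ball uniformization `Γ\𝔹² ≅ X₂(ℂ)` of a smooth
projective surface, `A : HodgeModel 2 X₂` a Hodge model of `X₂` (the complex manifold `X^an`) and
`𝔣` a Sylvester frame, so that `ψ = D.modelUnif A 𝔣 : ℂ² → X^an` is the uniformization read on
the standard ball (holomorphic on the ball, `unifHolomorphic`). In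
`UnitaryBallFormPullback` the pull-back `F_α(z) = (α_{ψ z}(dψ_z eᵢ))ᵢ` of a complex `1`-form
(resp. `F_α(z) = α_{ψ z}(dψ_z e₀, dψ_z e₁)` of a `2`-form) was shown to be an automorphic form on
`𝔹²` for the cotangent (resp. canonical) cocycle as soon as `α` is `ℂ`-linear in each tangent
vector. Here we add the analytic half of the dictionary:

* `differentiableAt_mform_unifDeriv` — if `η` is a **holomorphic `k`-form in charts**
  (`Literature.Geometry.Kaehler.IsHolomorphicInCharts`: in the preferred chart at each point the
  representative of `η` is the restriction of scalars of an analytic `ℂ`-multilinear germ), then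
  for constant vectors `v₁, …, v_k ∈ ℂ²` the function `w ↦ η_{ψ w}(dψ_w v₁, …, dψ_w v_k)` is
  complex-differentiable at every point of the ball. Proof: near `z`, with `c` the chart of
  `X^an` at `ψ z` and `Y = c ∘ ψ` (holomorphic, as `c` and `ψ` are), the chain rule
  `dψ_w = d(c⁻¹)_{Y w} ∘ dY_w` identifies the function with the chart representative
  `η.inChart (ψ z)` evaluated at `Y w` on the vectors `dY_w vᵢ`, i.e. with
  `w ↦ g(Y w)(∂_{v₁}Y(w), …, ∂_{v_k}Y(w))` for the analytic germ `g`; the directional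
  derivatives `∂_{vᵢ} Y` of the holomorphic map `Y` are holomorphic
  (`SCV.differentiableOn_fderiv_apply`), and evaluation of a continuous alternating map is jointly
  differentiable (`DifferentiableAt.continuousAlternatingMap_apply`).
* `formPullback₁_mem_holomorphic`, `formPullback₂_mem_holomorphic` — hence the pull-backs of
  holomorphic `1`- and `2`-forms are holomorphic functions on `𝔹²`, and
* `formPullback₁_mem_holAutForms`, `formPullback₂_mem_holAutForms` — they are **holomorphic
  automorphic forms** of level `Δ ≤ Γ` for the cotangent cocycle `J(γ,z)⁻ᵀ` (resp. the canonical
  cocycle `det J(γ,z)⁻¹`): the ball analogue of "a holomorphic `m`-differential on `Γ\ℍ` is a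
  holomorphic automorphic form of weight `2m`" (Borel (1997), §5.14).

All statements are theorems (no records).

References: A. Borel, *Automorphic forms on `SL₂(ℝ)`* (1997), §5.14; C. Voisin, *Hodge Theory
and Complex Algebraic Geometry I* (2002), §2.2.1 (holomorphic maps, `ℂ`-linear differentials);
D. Huybrechts, *Complex Geometry* (2005), Def. 2.2.14 (holomorphic forms in local coordinates).
-/

noncomputable section

open Matrix MulAction Function Set Filter
open scoped Manifold Topology
open Literature.Geometry.ComplexHyperbolic
open Literature.Geometry.ComplexHyperbolic.BallModel (U21 Ball Jac x₀ nsq actVec)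
open Literature.Geometry.Kaehler (MForm IsHolomorphicInCharts holFormsInCharts)
open Literature.NumberTheory.Transcendental
open Literature.NumberTheory.Automorphic.AutomorphyFactor
open Literature.AlgebraicGeometry.HodgeTheory (HodgeModel)
open Literature.Analysis.Complex

namespace Literature.AlgebraicGeometry.ShimuraVarieties

namespace UnitaryBallUniformisationDatum

variable {X₂ : Motives.SchemeOver ℂ} {D : UnitaryBallUniformisationDatum 2 X₂} {A : HodgeModel 2 X₂}
  {𝔣 : D.SylvesterFrame}

/-! ### Holomorphy of `w ↦ η_{ψ w}(dψ_w v₁, …, dψ_w v_k)` -/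

/-- **Holomorphic forms evaluate holomorphically along the uniformization.** If `η` is a
holomorphic `k`-form on `X^an` (holomorphic in charts) and `v₁, …, v_k ∈ ℂ²` are constant
vectors, then `w ↦ η_{ψ w}(dψ_w v₁, …, dψ_w v_k)` is complex-differentiable at every point of
the ball (`ψ = modelUnif`). In the chart `c` at `ψ z`, with `Y = c ∘ ψ`, the function is
`g(Y w)(∂_{v₁}Y, …, ∂_{v_k}Y)` for the analytic germ `g` representing `η`; `Y` and its
directional derivatives are holomorphic. [cite: VoisinHodgeI2002, §2.2.1] -/
theorem differentiableAt_mform_unifDeriv {k : ℕ} {η : MForm 𝓘(ℝ, A.model) A.carrier ℂ k}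
    (hη : IsHolomorphicInCharts η) (v : Fin k → (Fin 2 → ℂ)) (z : Ball) :
    DifferentiableAt ℂ
      (fun w ↦ η (D.modelUnif A 𝔣 w) fun i ↦ D.unifDeriv A 𝔣 w (v i)) z.1 := by
  set ψ := D.modelUnif A 𝔣 with hψ
  -- the chart at `x = ψ z` and the composite `Y = c ∘ ψ`
  set x : A.carrier := ψ z.1 with hx
  set Y : (Fin 2 → ℂ) → A.model := fun w ↦ extChartAt 𝓘(ℝ, A.model) x (ψ w) with hY
  -- the open set of ball points mapped into the chart domain
  set O : Set (Fin 2 → ℂ) := BallForms.ballSet ∩ ψ ⁻¹' (chartAt A.model x).source with hO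
  have hOo : IsOpen O :=
    (D.continuousOn_modelUnif A 𝔣).isOpen_inter_preimage BallForms.isOpen_ballSet
      (chartAt A.model x).open_source
  have hzO : z.1 ∈ O := ⟨BallForms.coe_mem_ballSet z, mem_chart_source _ x⟩
  have hsrc : ∀ w ∈ O, ψ w ∈ (extChartAt 𝓘(ℝ, A.model) x).source := fun w hw ↦ by
    rw [extChartAt_source]; exact hw.2
  have htgt : ∀ w ∈ O, Y w ∈ (extChartAt 𝓘(ℝ, A.model) x).target := fun w hw ↦
    (extChartAt 𝓘(ℝ, A.model) x).map_source (hsrc w hw)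
  have hleft : ∀ w ∈ O, (extChartAt 𝓘(ℝ, A.model) x).symm (Y w) = ψ w := fun w hw ↦
    (extChartAt 𝓘(ℝ, A.model) x).left_inv (hsrc w hw)
  -- `Y` is holomorphic on `O` (holomorphic chart after the holomorphic uniformization)
  have hYd : DifferentiableOn ℂ Y O := fun w hw ↦ by
    have h1 : MDifferentiableAt 𝓘(ℂ, Fin 2 → ℂ) 𝓘(ℂ, A.model) ψ w :=
      (D.unifHolomorphic A 𝔣).mdifferentiableAt (BallForms.isOpen_ballSet.mem_nhds hw.1)
    have h2 : MDifferentiableAt 𝓘(ℂ, A.model) 𝓘(ℂ, A.model)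
        (extChartAt 𝓘(ℂ, A.model) x) (ψ w) :=
      mdifferentiableAt_extChartAt hw.2
    exact (mdifferentiableAt_iff_differentiableAt.1 (h2.comp w h1)).differentiableWithinAt
  -- the real chain rule `dψ_w = d(c⁻¹)_{Y w} ∘ dY_w` on `O`
  have hder : ∀ w ∈ O, D.unifDeriv A 𝔣 w =
      (mfderivWithin 𝓘(ℝ, A.model) 𝓘(ℝ, A.model) (extChartAt 𝓘(ℝ, A.model) x).symm
        (range 𝓘(ℝ, A.model)) (Y w)).comp (fderiv ℝ Y w) := fun w hw ↦ by
    have hYw : DifferentiableAt ℂ Y w := hYd.differentiableAt (hOo.mem_nhds hw)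
    have h1 : HasMFDerivAt 𝓘(ℝ, Fin 2 → ℂ) 𝓘(ℝ, A.model) Y w (fderiv ℝ Y w) :=
      hasMFDerivAt_iff_hasFDerivAt.2 (hYw.restrictScalars ℝ).hasFDerivAt
    have h2 : HasMFDerivAt 𝓘(ℝ, A.model) 𝓘(ℝ, A.model) (extChartAt 𝓘(ℝ, A.model) x).symm
        (Y w) (mfderivWithin 𝓘(ℝ, A.model) 𝓘(ℝ, A.model) (extChartAt 𝓘(ℝ, A.model) x).symm
          (range 𝓘(ℝ, A.model)) (Y w)) :=
      (mdifferentiableWithinAt_extChartAt_symm (htgt w hw)).hasMFDerivWithinAt.hasMFDerivAt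
        (by rw [ModelWithCorners.Boundaryless.range_eq_univ]; exact univ_mem)
    have hev : ψ =ᶠ[𝓝 w] (extChartAt 𝓘(ℝ, A.model) x).symm ∘ Y := by
      filter_upwards [hOo.mem_nhds hw] with w' hw'
      exact (hleft w' hw').symm
    exact ((h2.comp w h1).congr_of_eventuallyEq hev).mfderiv
  -- hence the pulled-back form is the chart representative evaluated on `dY_w vᵢ`
  have hform : ∀ w ∈ O, η (ψ w) (fun i ↦ D.unifDeriv A 𝔣 w (v i)) =
      η.inChart x (Y w) fun i ↦ fderiv ℝ Y w (v i) := fun w hw ↦ by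
    have key : ∀ {p q : A.carrier} (u : Fin k → A.model), p = q → η p u = η q u := by
      rintro p q u rfl; rfl
    rw [Literature.Geometry.Kaehler.MForm.inChart_apply]
    simp only [hder w hw]
    exact key _ (hleft w hw).symm
  -- the analytic germ representing `η` in the chart at `x`
  obtain ⟨g, hg, heq⟩ := hη x
  have hYz : extChartAt 𝓘(ℝ, A.model) x x = Y z.1 := rfl
  rw [hYz] at hg heq
  have hYc : ContinuousAt Y z.1 := (hYd.differentiableAt (hOo.mem_nhds hzO)).continuousAt
  have hev : (fun w ↦ η (ψ w) fun i ↦ D.unifDeriv A 𝔣 w (v i)) =ᶠ[𝓝 z.1]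
      fun w ↦ g (Y w) fun i ↦ fderiv ℂ Y w (v i) := by
    filter_upwards [hOo.mem_nhds hzO, hYc.tendsto.eventually heq] with w hw hw'
    simp only [hform w hw, hw', ContinuousAlternatingMap.coe_restrictScalars,
      (hYd.differentiableAt (hOo.mem_nhds hw)).fderiv_restrictScalars (𝕜 := ℝ),
      ContinuousLinearMap.coe_restrictScalars']
  have hd : DifferentiableAt ℂ (fun w ↦ g (Y w) fun i ↦ fderiv ℂ Y w (v i)) z.1 :=
    (hg.differentiableAt.comp z.1 (hYd.differentiableAt (hOo.mem_nhds hzO)))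
      |>.continuousAlternatingMap_apply fun i ↦
        (SCV.differentiableOn_fderiv_apply hYd hOo (v i)).differentiableAt (hOo.mem_nhds hzO)
  exact hd.congr_of_eventuallyEq hev

/-! ### Holomorphic automorphic forms from holomorphic `1`- and `2`-forms -/

/-- **The pull-back of a holomorphic `1`-form is a holomorphic function on `𝔹²`.**
[cite: Borel1997, §5.14] -/
theorem formPullback₁_mem_holomorphic {α : MForm 𝓘(ℝ, A.model) A.carrier ℂ 1}
    (hα : IsHolomorphicInCharts α) :
    D.formPullback₁ A 𝔣 α ∈ BallForms.holomorphic (Fin 2 → ℂ) := by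
  intro w hw
  have hev : BallForms.extend (Fin 2 → ℂ) (D.formPullback₁ A 𝔣 α) =ᶠ[𝓝 w]
      fun w' i ↦ α (D.modelUnif A 𝔣 w') fun _ ↦ D.unifDeriv A 𝔣 w' (Pi.single i 1) := by
    filter_upwards [BallForms.isOpen_ballSet.mem_nhds hw] with w' hw'
    exact BallForms.extend_apply_coe (D.formPullback₁ A 𝔣 α) ⟨w', hw'⟩
  refine (DifferentiableAt.congr_of_eventuallyEq ?_ hev).differentiableWithinAt
  exact differentiableAt_pi.2 fun i ↦
    differentiableAt_mform_unifDeriv hα (fun _ ↦ Pi.single i 1) ⟨w, hw⟩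

/-- **The pull-back of a holomorphic `2`-form is a holomorphic function on `𝔹²`.**
[cite: Borel1997, §5.14] -/
theorem formPullback₂_mem_holomorphic {α : MForm 𝓘(ℝ, A.model) A.carrier ℂ 2}
    (hα : IsHolomorphicInCharts α) :
    D.formPullback₂ A 𝔣 α ∈ BallForms.holomorphic ℂ := by
  intro w hw
  have hev : BallForms.extend ℂ (D.formPullback₂ A 𝔣 α) =ᶠ[𝓝 w]
      fun w' ↦ α (D.modelUnif A 𝔣 w') fun i ↦
        D.unifDeriv A 𝔣 w' (![Pi.single 0 1, Pi.single 1 1] i) := by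
    filter_upwards [BallForms.isOpen_ballSet.mem_nhds hw] with w' hw'
    rw [show BallForms.extend ℂ (D.formPullback₂ A 𝔣 α) w' = D.formPullback₂ A 𝔣 α ⟨w', hw'⟩
      from BallForms.extend_apply_coe (D.formPullback₂ A 𝔣 α) ⟨w', hw'⟩, formPullback₂_apply]
    congr 1
    funext i
    fin_cases i <;> rfl
  refine (DifferentiableAt.congr_of_eventuallyEq ?_ hev).differentiableWithinAt
  exact differentiableAt_mform_unifDeriv hα ![Pi.single 0 1, Pi.single 1 1] ⟨w, hw⟩

/-- **Holomorphic `1`-forms pull back to holomorphic automorphic forms for the cotangent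
cocycle** `J(γ, z)⁻ᵀ`, of any level `Δ ≤ Γ`. [cite: Borel1997, §5.14] -/
theorem formPullback₁_mem_holAutForms {α : MForm 𝓘(ℝ, A.model) A.carrier ℂ 1}
    (hα : IsHolomorphicInCharts α) (Δ : Subgroup D.Γ) :
    D.formPullback₁ A 𝔣 α ∈ D.holAutForms 𝔣 Δ BallForms.cotangentCocycle :=
  BallForms.mem_holFactorForms_iff.2
    ⟨formPullback₁_mem_factorForms_of_isOfType hα.isOfType Δ, formPullback₁_mem_holomorphic hα⟩

/-- **Holomorphic `2`-forms pull back to holomorphic automorphic forms for the canonical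
cocycle** `det J(γ, z)⁻¹`, of any level `Δ ≤ Γ`. [cite: Borel1997, §5.14] -/
theorem formPullback₂_mem_holAutForms {α : MForm 𝓘(ℝ, A.model) A.carrier ℂ 2}
    (hα : IsHolomorphicInCharts α) (Δ : Subgroup D.Γ) :
    D.formPullback₂ A 𝔣 α ∈ D.holAutForms 𝔣 Δ (BallForms.canonicalCocycle ℂ 1) :=
  BallForms.mem_holFactorForms_iff.2
    ⟨formPullback₂_mem_factorForms_of_isOfType hα.isOfType Δ, formPullback₂_mem_holomorphic hα⟩

/-- **The holomorphic pull-back map in degree `1`**: the `ℂ`-linear map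
`Ω¹(X^an) → 𝒜_hol(Δ, J⁻ᵀ)` from the holomorphic `1`-forms of `X^an`
(`Literature.Geometry.Kaehler.holFormsInCharts`) to the holomorphic automorphic forms of level
`Δ` for the cotangent cocycle. [cite: Borel1997, §5.14] -/
def holFormPullback₁ (D : UnitaryBallUniformisationDatum 2 X₂) (A : HodgeModel 2 X₂)
    (𝔣 : D.SylvesterFrame) (Δ : Subgroup D.Γ) :
    holFormsInCharts A.model A.carrier 1 →ₗ[ℂ] D.holAutForms 𝔣 Δ BallForms.cotangentCocycle where
  toFun α := ⟨D.formPullback₁ A 𝔣 α.1, formPullback₁_mem_holAutForms α.2 Δ⟩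
  map_add' _ _ := rfl
  map_smul' _ _ := rfl

/-- **The holomorphic pull-back map in degree `2`**: `Ω²(X^an) → 𝒜_hol(Δ, det J⁻¹)`
(canonical cocycle). [cite: Borel1997, §5.14] -/
def holFormPullback₂ (D : UnitaryBallUniformisationDatum 2 X₂) (A : HodgeModel 2 X₂)
    (𝔣 : D.SylvesterFrame) (Δ : Subgroup D.Γ) :
    holFormsInCharts A.model A.carrier 2 →ₗ[ℂ]
      D.holAutForms 𝔣 Δ (BallForms.canonicalCocycle ℂ 1) where
  toFun α := ⟨D.formPullback₂ A 𝔣 α.1, formPullback₂_mem_holAutForms α.2 Δ⟩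
  map_add' _ _ := rfl
  map_smul' _ _ := rfl

/-- Unfolding `holFormPullback₁`. [folklore] -/
@[simp] theorem coe_holFormPullback₁ (Δ : Subgroup D.Γ) (α : holFormsInCharts A.model A.carrier 1) :
    (D.holFormPullback₁ A 𝔣 Δ α : Ball → (Fin 2 → ℂ)) = D.formPullback₁ A 𝔣 α.1 :=
  rfl

/-- Unfolding `holFormPullback₂`. [folklore] -/
@[simp] theorem coe_holFormPullback₂ (Δ : Subgroup D.Γ) (α : holFormsInCharts A.model A.carrier 2) :
    (D.holFormPullback₂ A 𝔣 Δ α : Ball → ℂ) = D.formPullback₂ A 𝔣 α.1 :=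
  rfl

/-- **Compatibility with change of level**: for `Δ ≤ Δ'` the pull-back of level `Δ'` followed by
the inclusion `𝒜_hol(Δ') ≤ 𝒜_hol(Δ)` is the pull-back of level `Δ` (both are `F_α`).
[folklore] -/
theorem holAutForms_inclusion_holFormPullback₁ {Δ Δ' : Subgroup D.Γ} (h : Δ ≤ Δ')
    (α : holFormsInCharts A.model A.carrier 1) :
    Submodule.inclusion (D.holAutForms_anti 𝔣 h BallForms.cotangentCocycle)
      (D.holFormPullback₁ A 𝔣 Δ' α) = D.holFormPullback₁ A 𝔣 Δ α :=
  rfl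

/-- Degree-`2` version of `holAutForms_inclusion_holFormPullback₁`. [folklore] -/
theorem holAutForms_inclusion_holFormPullback₂ {Δ Δ' : Subgroup D.Γ} (h : Δ ≤ Δ')
    (α : holFormsInCharts A.model A.carrier 2) :
    Submodule.inclusion (D.holAutForms_anti 𝔣 h (BallForms.canonicalCocycle ℂ 1))
      (D.holFormPullback₂ A 𝔣 Δ' α) = D.holFormPullback₂ A 𝔣 Δ α :=
  rfl

end UnitaryBallUniformisationDatum

end Literature.AlgebraicGeometry.ShimuraVarieties

end
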